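import Summits.MatrixMultiplication.MatrixMultiplication.Theorems.SoloBlindKraftSets

/-!
# Calculus of Kraft masses: the deletion identity, cones, and the exact pair identity

Sub-programme (K₃) / Conjecture E.  For `h : ι → G` and a target `τ` the Kraft mass is
`K(τ; S) = ∑_{T ⊆ S, ∑_T h = τ} 2^{-|T|}` (`soloBlindMass`).  Three exact identities used throughout the pen analysis
(K3.23.10, K3.24.3) are recorded here in the kernel.

* DELETION IDENTITY (`soloBlind_mass_erase`, no hypotheses): for `v ∈ S`,
  `K(τ; S) = K(τ; S \ v) + K(τ - h v; S \ v) / 2` — a representation either avoids `v` or is `U ∪ {v}` with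
  `∑_U h = τ - h v`.
* CONE IDENTITY (`soloBlind_mass_cone`): if every representation of `τ` contains `v` then
  `K(τ; S) = K(τ - h v; S \ v) / 2`.
* EXACT PAIR IDENTITY (`soloBlind_mass_pair_exact`): if `h` is zero-sum free on `S`, `τ` is H-good
  (`∑_T h ≠ τ + τ`) and `{x, y}` represents `τ`, then with `W = S \ {x, y}`
  `E(τ; S) = 1/4 + K(h x; W) / 2 + K(h y; W) / 2`,
  because every other representation contains exactly one of `x, y` (`soloBlind_rep_erase_contains_partner`).  Hence
  (`soloBlind_conjE_pair_iff`) `E(τ; S) ≤ 1/2 ↔ K(h x; W) + K(h y; W) ≤ 1/2` — the two-target form E² of Conjecture E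
  at a pair member.
-/

namespace Summit.MatrixMultiplication.MatrixMultiplication.Theorems

open Finset

universe u

variable {ι : Type*} [DecidableEq ι]
variable {G : Type u} [AddCommGroup G] [DecidableEq G]

/-- The representations of `τ` containing `v ∈ S` are exactly `insert v U` for the representations `U` of `τ - h v`
inside `S \ v`. -/
theorem soloBlind_repAll_filter_mem (h : ι → G) {S : Finset ι} {v : ι} (hv : v ∈ S) (τ : G) :
    (soloBlindSeqRepAll h S τ).filter (fun T => v ∈ T) =
      (soloBlindSeqRepAll h (S.erase v) (τ - h v)).image (insert v) := by
  ext T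
  rw [Finset.mem_filter, Finset.mem_image, soloBlind_mem_seqRepAll]
  constructor
  · rintro ⟨⟨hTS, hsum⟩, hvT⟩
    refine ⟨T.erase v, ?_, Finset.insert_erase hvT⟩
    rw [soloBlind_mem_seqRepAll]
    refine ⟨Finset.erase_subset_erase v hTS, ?_⟩
    rw [Finset.sum_erase_eq_sub hvT, hsum]
  · rintro ⟨U, hU, rfl⟩
    rw [soloBlind_mem_seqRepAll] at hU
    obtain ⟨hUS, hUsum⟩ := hU
    have hvU : v ∉ U := fun hvU => Finset.notMem_erase v S (hUS hvU)
    refine ⟨⟨?_, ?_⟩, Finset.mem_insert_self v U⟩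
    · exact Finset.insert_subset hv (hUS.trans (Finset.erase_subset v S))
    · rw [Finset.sum_insert hvU, hUsum, add_sub_cancel]

/-- The representations of `τ` avoiding `v` are the representations of `τ` inside `S \ v`. -/
theorem soloBlind_repAll_filter_not_mem (h : ι → G) (S : Finset ι) (v : ι) (τ : G) :
    (soloBlindSeqRepAll h S τ).filter (fun T => v ∉ T) = soloBlindSeqRepAll h (S.erase v) τ := by
  ext T
  rw [Finset.mem_filter, soloBlind_mem_seqRepAll, soloBlind_mem_seqRepAll]
  constructor
  · rintro ⟨⟨hTS, hsum⟩, hvT⟩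
    exact ⟨fun i hi => Finset.mem_erase.mpr ⟨fun e => hvT (e ▸ hi), hTS hi⟩, hsum⟩
  · rintro ⟨hTS, hsum⟩
    exact ⟨⟨hTS.trans (Finset.erase_subset v S), hsum⟩, fun hvT => Finset.notMem_erase v S (hTS hvT)⟩

/-- DELETION IDENTITY (no hypotheses): `K(τ; S) = K(τ; S \ v) + K(τ - h v; S \ v) / 2` for `v ∈ S`. -/
theorem soloBlind_mass_erase (h : ι → G) {S : Finset ι} {v : ι} (hv : v ∈ S) (τ : G) :
    soloBlindMass h S τ =
      soloBlindMass h (S.erase v) τ + 1 / 2 * soloBlindMass h (S.erase v) (τ - h v) := by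
  rw [soloBlindMass, ← Finset.sum_filter_add_sum_filter_not _ (fun T => v ∈ T), add_comm,
    soloBlind_repAll_filter_not_mem, soloBlind_repAll_filter_mem h hv, soloBlindMass, soloBlindMass]
  congr 1
  rw [Finset.sum_image, Finset.mul_sum]
  · refine Finset.sum_congr rfl fun U hU => ?_
    have hvU : v ∉ U := fun hvU =>
      Finset.notMem_erase v S ((soloBlind_mem_seqRepAll.mp hU).1 hvU)
    rw [Finset.card_insert_of_notMem hvU, pow_succ, mul_comm]
  · intro U₁ hU₁ U₂ hU₂ e
    have h₁ : v ∉ U₁ := fun hvU =>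
      Finset.notMem_erase v S ((soloBlind_mem_seqRepAll.mp (Finset.mem_coe.mp hU₁)).1 hvU)
    have h₂ : v ∉ U₂ := fun hvU =>
      Finset.notMem_erase v S ((soloBlind_mem_seqRepAll.mp (Finset.mem_coe.mp hU₂)).1 hvU)
    rw [← Finset.erase_insert h₁, ← Finset.erase_insert h₂, e]

/-- CONE IDENTITY: if every representation of `τ` in `S` contains `v ∈ S` (the family is a cone with apex `v`), then
`K(τ; S) = K(τ - h v; S \ v) / 2`. -/
theorem soloBlind_mass_cone (h : ι → G) {S : Finset ι} {v : ι} (hv : v ∈ S) (τ : G)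
    (hcone : ∀ T ∈ soloBlindSeqRepAll h S τ, v ∈ T) :
    soloBlindMass h S τ = 1 / 2 * soloBlindMass h (S.erase v) (τ - h v) := by
  rw [soloBlind_mass_erase h hv τ]
  have hempty : soloBlindSeqRepAll h (S.erase v) τ = ∅ := by
    rw [← soloBlind_repAll_filter_not_mem, Finset.filter_eq_empty_iff]
    intro T hT hvT
    exact hvT (hcone T hT)
  rw [soloBlindMass, hempty, Finset.sum_empty, zero_add]

/-- For an H-good `τ` with a pair representation `{x, y}`: every representation of `τ` avoiding `x` contains `y`
(otherwise it is disjoint from `{x, y}` and the union sums to `τ + τ`). -/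
theorem soloBlind_rep_erase_contains_partner {h : ι → G} {S : Finset ι} {τ : G}
    (hgood : ∀ T ⊆ S, ∑ i ∈ T, h i ≠ τ + τ) {x y : ι} (hx : x ∈ S) (hy : y ∈ S) (hxy : x ≠ y)
    (hsum : h x + h y = τ) : ∀ T ∈ soloBlindSeqRepAll h (S.erase x) τ, y ∈ T := by
  intro T hT
  obtain ⟨hTS, hTsum⟩ := soloBlind_mem_seqRepAll.mp hT
  by_contra hyT
  have hxT : x ∉ T := fun hxT => Finset.notMem_erase x S (hTS hxT)
  have hdisj : Disjoint T {x, y} := by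
    rw [Finset.disjoint_insert_right, Finset.disjoint_singleton_right]
    exact ⟨hxT, hyT⟩
  apply hgood (T ∪ {x, y})
  · refine Finset.union_subset (hTS.trans (Finset.erase_subset x S)) ?_
    exact Finset.insert_subset hx (Finset.singleton_subset_iff.mpr hy)
  · rw [Finset.sum_union hdisj, Finset.sum_pair hxy, hTsum, hsum]

/-- EXACT PAIR IDENTITY: for `h` zero-sum free on `S`, `τ` H-good and a pair representation `{x, y}` of `τ`,
`E(τ; S) = 1/4 + K(h x; W) / 2 + K(h y; W) / 2` with `W = S \ {x, y}`. -/
theorem soloBlind_mass_pair_exact {h : ι → G} {S : Finset ι}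
    (zsf : ∀ T ⊆ S, T.Nonempty → ∑ i ∈ T, h i ≠ 0) {τ : G} (hgood : ∀ T ⊆ S, ∑ i ∈ T, h i ≠ τ + τ)
    {x y : ι} (hx : x ∈ S) (hy : y ∈ S) (hxy : x ≠ y) (hsum : h x + h y = τ) :
    soloBlindMass h S τ = 1 / 4 + 1 / 2 * soloBlindMass h ((S.erase x).erase y) (h x) +
      1 / 2 * soloBlindMass h ((S.erase x).erase y) (h y) := by
  have hy' : y ∈ S.erase x := Finset.mem_erase.mpr ⟨fun e => hxy e.symm, hy⟩
  have zsf' : ∀ T ⊆ S.erase x, T.Nonempty → ∑ i ∈ T, h i ≠ 0 :=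
    fun T hT hne => zsf T (hT.trans (Finset.erase_subset x S)) hne
  -- delete `x`
  rw [soloBlind_mass_erase h hx τ]
  -- the `τ`-representations avoiding `x` form a cone with apex `y`
  rw [soloBlind_mass_cone h hy' τ (soloBlind_rep_erase_contains_partner hgood hx hy hxy hsum)]
  -- the targets: `τ - h y = h x`, `τ - h x = h y`
  have e1 : τ - h y = h x := by rw [← hsum, add_sub_cancel_right]
  have e2 : τ - h x = h y := by rw [← hsum, add_sub_cancel_left]
  rw [e1, e2, soloBlind_mass_value_split zsf' hy']
  ring

/-- E² FORM OF CONJECTURE E AT A PAIR MEMBER: under the hypotheses of `soloBlind_mass_pair_exact`,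
`E(τ; S) ≤ 1/2 ↔ K(h x; W) + K(h y; W) ≤ 1/2`. -/
theorem soloBlind_conjE_pair_iff {h : ι → G} {S : Finset ι}
    (zsf : ∀ T ⊆ S, T.Nonempty → ∑ i ∈ T, h i ≠ 0) {τ : G} (hgood : ∀ T ⊆ S, ∑ i ∈ T, h i ≠ τ + τ)
    {x y : ι} (hx : x ∈ S) (hy : y ∈ S) (hxy : x ≠ y) (hsum : h x + h y = τ) :
    soloBlindMass h S τ ≤ 1 / 2 ↔
      soloBlindMass h ((S.erase x).erase y) (h x) + soloBlindMass h ((S.erase x).erase y) (h y) ≤ 1 / 2 := by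
  rw [soloBlind_mass_pair_exact zsf hgood hx hy hxy hsum]
  constructor <;> intro H <;> linarith

end Summit.MatrixMultiplication.MatrixMultiplication.Theorems
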